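import Mathlib

/-!
# Tier3MultiplicityTransfer — the multiplicity-space structure of the Rallis inner product (T3.5 for T3.1)

PERIOD.md §4.3 (b1)–(b5) expands `θ₀ ∧ θ₁` along the irreducible summands `τ` of `L²([U(W)])` and
isolates ONE summand `τ₀ = Θ_{L,W}(β)`; the identification `u_N = u_{τ₀}` (PERIOD-ADDENDUM-2 §A3)
silently uses that `τ₀` occurs ONCE in `L²([U(W)])` (`U(W)` the definite `U(2)`, an inner form —
Rogawski Ch. 11 prints the multiplicity formula for the quasi-split `U(2)` only).

PERIOD-ADDENDUM-9 shows this is not an additional input: by the doubling seesaw (N. Harris, IMRN 2012,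
(5.6)–(5.7), Definition 5.7, Theorem 5.8) the Hermitian form `(f₁, f₂) ↦ ⟨θ(f̄₁, ϕ₁), θ(f̄₂, ϕ₂)⟩` on
`L²([U(W)])` is the value at `s = ½` of `⟨T_s f₁, f₂⟩`, `T_s = ∫ Φ_s(δ ι(g,1)) R(g) dg`, and `T_s` acts on
the `τ`-isotypic block `τ ⊗ ℂ^m` as `τ(Φ_s) ⊗ 1`; hence on the copies `τ ⊗ e_i` (`e_i` orthonormal)
`⟨θ(f̄₁, ϕ₁), θ(f̄₂, ϕ₂)⟩ = ⟨e₁, e₂⟩ · Z(½; v₁, v₂)` — the lifts of distinct copies are ORTHOGONAL and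
all NON-ZERO as soon as one is.  This file is the kernel twin of the consequence: if the lifts of the copies
all land in a SIMPLE module (the `π`-isotypic part of `A(U(V))`, simple by Rogawski's `m(π) ≤ 1`), there is
at most ONE copy — `m(τ) ≤ m(π) ≤ 1` for every `τ` that lifts non-trivially, in particular for `τ₀`.

Vocabulary: `R` a ring (the group algebra / Hecke algebra of `U(V)`), `M` the source (`L²([U(W)])`), `P` the
target (`A(U(V))`), `Λ : M →ₗ[R] P` the theta lift, `f i : τ →ₗ[R] M` the `i`-th copy of `τ`, `B` an additive
pairing on `P` (the Petersson inner product), `S` the pairing on `τ` (the Rallis zeta value `Z(½; v, w)`), and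
the factorised form `B (Λ (f i v)) (Λ (f j w)) = if i = j then S v w else 0`.  No definition, no notation,
`import Mathlib` only.  Nothing here asserts anything about the original programme; HC_CM is NOT proved by
anyone in this repository.
-/

namespace HodgeRepro.T3P1.MultiplicityTransfer

variable {R τ M P k ι : Type*} [Ring R] [DecidableEq ι]
  [AddCommGroup τ] [Module R τ] [AddCommGroup M] [Module R M] [AddCommGroup P] [Module R P]
  [AddCommGroup k]

/-- The `i`-th lifted copy pairs non-trivially with itself as soon as `S` does: for `v w` with
`S v w ≠ 0`, `Λ (f i v) ≠ 0`. -/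
theorem lift_ne_zero_of_pairing_ne_zero (f : ι → τ →ₗ[R] M) (Λ : M →ₗ[R] P)
    (B : P →+ P →+ k) (S : τ → τ → k)
    (hB : ∀ i j v w, B (Λ (f i v)) (Λ (f j w)) = if i = j then S v w else 0)
    {i : ι} {v w : τ} (hS : S v w ≠ 0) : Λ (f i v) ≠ 0 := by
  intro h
  have h1 := hB i i v w
  rw [if_pos rfl, h, map_zero] at h1
  exact hS (by simpa using h1.symm)

/-- The range of the `i`-th lifted copy is non-zero as soon as `S` is. -/
theorem range_ne_bot_of_pairing_ne_zero (f : ι → τ →ₗ[R] M) (Λ : M →ₗ[R] P)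
    (B : P →+ P →+ k) (S : τ → τ → k)
    (hB : ∀ i j v w, B (Λ (f i v)) (Λ (f j w)) = if i = j then S v w else 0)
    (hS : ∃ v w, S v w ≠ 0) (i : ι) : LinearMap.range (Λ ∘ₗ f i) ≠ ⊥ := by
  obtain ⟨v, w, hvw⟩ := hS
  intro h
  have hmem : Λ (f i v) ∈ LinearMap.range (Λ ∘ₗ f i) := ⟨v, rfl⟩
  rw [h, Submodule.mem_bot] at hmem
  exact lift_ne_zero_of_pairing_ne_zero f Λ B S hB hvw hmem

/-- The lifts of two distinct copies are orthogonal: `B` vanishes on `range (Λ ∘ f i) × range (Λ ∘ f j)`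
for `i ≠ j`. -/
theorem pairing_eq_zero_of_ne (f : ι → τ →ₗ[R] M) (Λ : M →ₗ[R] P)
    (B : P →+ P →+ k) (S : τ → τ → k)
    (hB : ∀ i j v w, B (Λ (f i v)) (Λ (f j w)) = if i = j then S v w else 0)
    {i j : ι} (hij : i ≠ j) {x y : P} (hx : x ∈ LinearMap.range (Λ ∘ₗ f i))
    (hy : y ∈ LinearMap.range (Λ ∘ₗ f j)) : B x y = 0 := by
  obtain ⟨v, rfl⟩ := hx
  obtain ⟨w, rfl⟩ := hy
  simpa [hij] using hB i j v w

/-- A non-zero submodule of `P` contained in a simple submodule `Q` equals `Q`. -/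
theorem eq_of_le_of_ne_bot {N Q : Submodule R P} [IsSimpleModule R Q] (hNQ : N ≤ Q) (hN : N ≠ ⊥) :
    N = Q := by
  -- pull `N` back to a submodule of `Q`
  set N' : Submodule R Q := Submodule.comap Q.subtype N with hN'
  have hN'ne : N' ≠ ⊥ := by
    intro h
    apply hN
    rw [Submodule.eq_bot_iff]
    intro x hx
    have hxQ : x ∈ Q := hNQ hx
    have : (⟨x, hxQ⟩ : Q) ∈ N' := by simpa [hN'] using hx
    rw [h, Submodule.mem_bot] at this
    simpa using congrArg Subtype.val this
  have hN'top : N' = ⊤ := (eq_bot_or_eq_top N').resolve_left hN'ne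
  apply le_antisymm hNQ
  intro x hx
  have : (⟨x, hx⟩ : Q) ∈ N' := by rw [hN'top]; exact Submodule.mem_top
  simpa [hN'] using this

/-- **The multiplicity bound.** If the lifts of all copies land in a simple submodule `Q` of the target and
the factorised Rallis form is non-zero, then there is at most one copy: `i = j` for all `i j`. -/
theorem eq_of_range_le_simple (f : ι → τ →ₗ[R] M) (Λ : M →ₗ[R] P)
    (B : P →+ P →+ k) (S : τ → τ → k)
    (hB : ∀ i j v w, B (Λ (f i v)) (Λ (f j w)) = if i = j then S v w else 0)
    (hS : ∃ v w, S v w ≠ 0) (Q : Submodule R P) [IsSimpleModule R Q]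
    (hQ : ∀ i, LinearMap.range (Λ ∘ₗ f i) ≤ Q) (i j : ι) : i = j := by
  by_contra hij
  obtain ⟨v, w, hvw⟩ := hS
  have hi : LinearMap.range (Λ ∘ₗ f i) = Q :=
    eq_of_le_of_ne_bot (hQ i) (range_ne_bot_of_pairing_ne_zero f Λ B S hB ⟨v, w, hvw⟩ i)
  have hj : LinearMap.range (Λ ∘ₗ f j) = Q :=
    eq_of_le_of_ne_bot (hQ j) (range_ne_bot_of_pairing_ne_zero f Λ B S hB ⟨v, w, hvw⟩ j)
  -- `Λ (f i v)` lies in `Q = range (Λ ∘ f j)`, so it is orthogonal to `Λ (f i w)`; but it pairs to `S v w`.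
  have hmem : Λ (f i v) ∈ LinearMap.range (Λ ∘ₗ f j) := by
    rw [hj, ← hi]; exact ⟨v, rfl⟩
  have h0 : B (Λ (f i v)) (Λ (f i w)) = 0 :=
    pairing_eq_zero_of_ne f Λ B S hB (Ne.symm hij) hmem ⟨w, rfl⟩
  have h1 := hB i i v w
  rw [if_pos rfl] at h1
  exact hvw (h1.symm.trans h0)

/-- The same, as `Subsingleton ι`. -/
theorem subsingleton_of_range_le_simple (f : ι → τ →ₗ[R] M) (Λ : M →ₗ[R] P)
    (B : P →+ P →+ k) (S : τ → τ → k)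
    (hB : ∀ i j v w, B (Λ (f i v)) (Λ (f j w)) = if i = j then S v w else 0)
    (hS : ∃ v w, S v w ≠ 0) (Q : Submodule R P) [IsSimpleModule R Q]
    (hQ : ∀ i, LinearMap.range (Λ ∘ₗ f i) ≤ Q) : Subsingleton ι :=
  ⟨eq_of_range_le_simple f Λ B S hB hS Q hQ⟩

/-- The multiplicity count: with finitely many copies, at most one. -/
theorem card_le_one_of_range_le_simple [Fintype ι] (f : ι → τ →ₗ[R] M) (Λ : M →ₗ[R] P)
    (B : P →+ P →+ k) (S : τ → τ → k)
    (hB : ∀ i j v w, B (Λ (f i v)) (Λ (f j w)) = if i = j then S v w else 0)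
    (hS : ∃ v w, S v w ≠ 0) (Q : Submodule R P) [IsSimpleModule R Q]
    (hQ : ∀ i, LinearMap.range (Λ ∘ₗ f i) ≤ Q) : Fintype.card ι ≤ 1 :=
  Fintype.card_le_one_iff_subsingleton.mpr (subsingleton_of_range_le_simple f Λ B S hB hS Q hQ)

/-- Without the simplicity hypothesis: if `S` is non-degenerate in its first argument, the lifts of
distinct copies are independent submodules — `range (Λ ∘ f i) ⊓ range (Λ ∘ f j) = ⊥` for `i ≠ j` (an
element of both pairs to `0` with all of `range (Λ ∘ f i)`, which only `0` does).  This is the sense in which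
the copies' lifts are pairwise orthogonal non-zero submodules of the target, so that their number is bounded
by the multiplicity of the target: `m(τ) ≤ m(π)` in the notation of ADDENDUM-9. -/
theorem range_inf_eq_bot_of_nondegenerate (f : ι → τ →ₗ[R] M) (Λ : M →ₗ[R] P)
    (B : P →+ P →+ k) (S : τ → τ → k)
    (hB : ∀ i j v w, B (Λ (f i v)) (Λ (f j w)) = if i = j then S v w else 0)
    (hSnd : ∀ v, v ≠ 0 → ∃ w, S v w ≠ 0)
    {i j : ι} (hij : i ≠ j) :
    LinearMap.range (Λ ∘ₗ f i) ⊓ LinearMap.range (Λ ∘ₗ f j) = ⊥ := by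
  rw [Submodule.eq_bot_iff]
  intro x hx
  obtain ⟨⟨v, rfl⟩, hxj⟩ := Submodule.mem_inf.mp hx
  by_contra hne
  have hv : v ≠ 0 := by
    rintro rfl
    exact hne (by simp)
  obtain ⟨w, hvw⟩ := hSnd v hv
  have h0 : B (Λ (f i v)) (Λ (f i w)) = 0 :=
    pairing_eq_zero_of_ne f Λ B S hB (Ne.symm hij) hxj ⟨w, rfl⟩
  have h1 := hB i i v w
  rw [if_pos rfl] at h1
  exact hvw (h1.symm.trans h0)

end HodgeRepro.T3P1.MultiplicityTransfer
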